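import Mathlib.Probability.Moments.SubGaussian
import Mathlib.Analysis.Convex.SpecificFunctions.Basic
import Mathlib.Analysis.SpecialFunctions.Trigonometric.Series
import HarnessLib

/-!
# Route `ColdStartUniversality` (fixed-cut-off SZZ dynamics, sampler package): the AZUMA–HOEFFDING MECHANISM in elementary form —
# bounded increments ORTHOGONAL to the exponentials of their partial sums have sub-Gaussian sums

Helper file (seat `ym-line-csu-p1`, g34; `--supports stmt-QuantumFields-24809`).  Generic probability, no SZZ object: the engine of the
exponential (Hoeffding) concentration of ergodic averages of the cold-start Langevin sampler (next files).  On ANY probability space, let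
`D₀, D₁, …` be real random variables with `|D_k| ≤ B` and the ORTHOGONALITY `E[e^(λ S_k) · D_k] = 0` for all real `λ`, where
`S_k = D₀ + ⋯ + D_(k−1)` (this is all that "martingale differences" is used for; no conditional expectations, no filtration, no standard Borel
hypothesis).  Then
* `exp_mul_le_convex_comb` — convexity: `e^(λd) ≤ (B−d)/(2B)·e^(−λB) + (d+B)/(2B)·e^(λB)` for `|d| ≤ B`;
* ★ `integral_mul_exp_mul_le_of_orthogonal` — ONE HOEFFDING STEP with a non-negative bounded weight `Z`, `E[Z·D] = 0`, `|D| ≤ B`: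
  `E[Z e^(λD)] ≤ cosh(λB)·E[Z] ≤ e^(λ²B²/2)·E[Z]` (`Real.cosh_le_exp_half_sq`);
* ★★ `integral_exp_mul_sum_le_of_orthogonal` — `E[e^(λ S_n)] ≤ e^(n λ² B²/2)` (induction);
* ★★ `hasSubgaussianMGF_sum_of_orthogonal` — `S_n` is sub-Gaussian with parameter `n B²` (Mathlib's `HasSubgaussianMGF`);
* ★★ `measureReal_sum_ge_le_of_orthogonal` / `measureReal_abs_sum_ge_le_of_orthogonal` — the AZUMA–HOEFFDING TAILS
  `P[S_n ≥ r] ≤ exp(−r²/(2nB²))`, `P[|S_n| ≥ r] ≤ 2 exp(−r²/(2nB²))` (Chernoff, `HasSubgaussianMGF.measure_ge_le`).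
(Mathlib's `measure_sum_ge_le_of_hasCondSubgaussianMGF` is the conditional-kernel form of the same inequality; the orthogonality form here is
what the Markov property of the SZZ solutions delivers directly on an arbitrary probability space.)  THEOREMS ONLY, no definition, no sorry;
[folklore] (Hoeffding 1963, Azuma 1967; cf. [cite: GlynnOrmoneit2002, proof of Theorem 2]).  HONEST FRAMING: plumbing for fixed-cut-off sampler
statements; `UniformColdStartMixing` (24809) is NOT restated; no crux, rung or summit statement is proved; the Yang–Mills mass gap is NOT proved.
-/

set_option autoImplicit false

noncomputable section

namespace Summit.QuantumFields.YangMills.Theorems.ColdStartUniversality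

open MeasureTheory ProbabilityTheory Filter Finset
open scoped NNReal ENNReal BigOperators

variable {Ω : Type*} [MeasurableSpace Ω] {P : Measure Ω}

/-! ## §1. One Hoeffding step -/

/-- Convexity of the exponential on `[−B, B]`: for `|d| ≤ B`, `B > 0` and every real `λ`,
`e^(λd) ≤ (B − d)/(2B)·e^(−λB) + (d + B)/(2B)·e^(λB)`. [folklore] -/
theorem exp_mul_le_convex_comb {B d : ℝ} (hB : 0 < B) (hd : |d| ≤ B) (l : ℝ) :
    Real.exp (l * d) ≤ (B - d) / (2 * B) * Real.exp (-(l * B)) + (d + B) / (2 * B) * Real.exp (l * B) := by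
  have h1 : 0 ≤ (B - d) / (2 * B) := div_nonneg (by linarith [(abs_le.1 hd).2]) (by positivity)
  have h2 : 0 ≤ (d + B) / (2 * B) := div_nonneg (by linarith [(abs_le.1 hd).1]) (by positivity)
  have h3 : (B - d) / (2 * B) + (d + B) / (2 * B) = 1 := by
    field_simp
    ring
  have h := convexOn_exp.2 (Set.mem_univ (-(l * B))) (Set.mem_univ (l * B)) h1 h2 h3
  simp only [smul_eq_mul] at h
  have h2B : (2 * B) ≠ 0 := by positivity
  have heq : (B - d) / (2 * B) * (-(l * B)) + (d + B) / (2 * B) * (l * B) = l * d :=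
    calc (B - d) / (2 * B) * (-(l * B)) + (d + B) / (2 * B) * (l * B) = l * d * (2 * B) / (2 * B) := by ring
      _ = l * d := mul_div_cancel_right₀ _ h2B
  rwa [heq] at h

/-- ★ **One Hoeffding step with an orthogonal weight.**  On a finite measure space, let `Z ≥ 0` be bounded measurable, `D` measurable
with `|D| ≤ B` (`B > 0`) and `∫ Z·D = 0`.  Then for every real `λ`: `∫ Z·e^(λD) ≤ e^(λ²B²/2) · ∫ Z`
(convexity + `cosh x ≤ e^(x²/2)`). [folklore] -/
theorem integral_mul_exp_mul_le_of_orthogonal [IsFiniteMeasure P] {Z D : Ω → ℝ}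
    (hZm : Measurable Z) (hDm : Measurable D) {CZ B : ℝ} (hZ0 : ∀ ω, 0 ≤ Z ω) (hZb : ∀ ω, Z ω ≤ CZ)
    (hB : 0 < B) (hDb : ∀ ω, |D ω| ≤ B) (horth : ∫ ω, Z ω * D ω ∂P = 0) (l : ℝ) :
    ∫ ω, Z ω * Real.exp (l * D ω) ∂P ≤ Real.exp (l ^ 2 * B ^ 2 / 2) * ∫ ω, Z ω ∂P := by
  -- integrability of the bounded measurable integrands
  have hbdd : ∀ {φ : Ω → ℝ} {C : ℝ}, Measurable φ → (∀ ω, |φ ω| ≤ C) → Integrable (fun ω => Z ω * φ ω) P :=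
    fun {φ C} hφ hφb => (integrable_const (CZ * C)).mono' (hZm.mul hφ).aestronglyMeasurable
      (Eventually.of_forall fun ω => by
        rw [norm_mul, Real.norm_eq_abs, Real.norm_eq_abs, abs_of_nonneg (hZ0 ω)]
        exact mul_le_mul (hZb ω) (hφb ω) (abs_nonneg _) ((hZ0 ω).trans (hZb ω)))
  have hZi : Integrable Z P := by
    have h := hbdd (measurable_const (a := (1 : ℝ))) (fun _ => (abs_one.le : |(1 : ℝ)| ≤ 1))
    simpa using h
  have hZDi : Integrable (fun ω => Z ω * D ω) P := hbdd hDm hDb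
  have hEb : ∀ ω, |Real.exp (l * D ω)| ≤ Real.exp (|l| * B) := fun ω => by
    rw [abs_of_pos (Real.exp_pos _), Real.exp_le_exp]
    calc l * D ω ≤ |l * D ω| := le_abs_self _
      _ = |l| * |D ω| := abs_mul _ _
      _ ≤ |l| * B := mul_le_mul_of_nonneg_left (hDb ω) (abs_nonneg l)
  have hZEi : Integrable (fun ω => Z ω * Real.exp (l * D ω)) P := hbdd (hDm.const_mul l).exp hEb
  -- pointwise convexity bound, weighted by `Z ≥ 0`
  set R : Ω → ℝ := fun ω =>
    Z ω * ((B - D ω) / (2 * B) * Real.exp (-(l * B)) + (D ω + B) / (2 * B) * Real.exp (l * B)) with hR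
  have hpt : ∀ ω, Z ω * Real.exp (l * D ω) ≤ R ω := fun ω =>
    mul_le_mul_of_nonneg_left (exp_mul_le_convex_comb hB (hDb ω) l) (hZ0 ω)
  -- the right-hand side is affine in `D`; its integral is `cosh(λB) ∫Z` by orthogonality
  have hexp : ∀ ω, R ω = (Real.exp (-(l * B)) + Real.exp (l * B)) / 2 * Z ω +
      (Real.exp (l * B) - Real.exp (-(l * B))) / (2 * B) * (Z ω * D ω) := fun ω => by
    simp only [hR]
    field_simp
    ring
  have hRi : Integrable R P := by
    rw [show R = fun ω => (Real.exp (-(l * B)) + Real.exp (l * B)) / 2 * Z ω +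
      (Real.exp (l * B) - Real.exp (-(l * B))) / (2 * B) * (Z ω * D ω) from funext hexp]
    exact (hZi.const_mul _).add (hZDi.const_mul _)
  have hrhs : ∫ ω, R ω ∂P = Real.cosh (l * B) * ∫ ω, Z ω ∂P := by
    rw [integral_congr_ae (ae_of_all _ hexp), integral_add (hZi.const_mul _) (hZDi.const_mul _), integral_const_mul,
      integral_const_mul, horth, mul_zero, add_zero, Real.cosh_eq]
    ring
  calc ∫ ω, Z ω * Real.exp (l * D ω) ∂P ≤ ∫ ω, R ω ∂P := integral_mono hZEi hRi hpt
    _ = Real.cosh (l * B) * ∫ ω, Z ω ∂P := hrhs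
    _ ≤ Real.exp ((l * B) ^ 2 / 2) * ∫ ω, Z ω ∂P :=
        mul_le_mul_of_nonneg_right (Real.cosh_le_exp_half_sq _) (integral_nonneg hZ0)
    _ = Real.exp (l ^ 2 * B ^ 2 / 2) * ∫ ω, Z ω ∂P := by rw [mul_pow]

/-! ## §2. Sub-Gaussian sums of orthogonal bounded increments -/

/-- ★★ **Moment generating function of a sum of orthogonal bounded increments.**  On a probability space let `D₀, D₁, …` be measurable
with `|D_k| ≤ B` (`B > 0`), and suppose `∫ e^(λ S_k)·D_k dP = 0` for all `k < n` and all real `λ`, `S_k = Σ_(j<k) D_j`.  Then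
`∫ e^(λ S_n) dP ≤ e^(n·λ²B²/2)` for every real `λ`. [folklore] -/
theorem integral_exp_mul_sum_le_of_orthogonal [IsProbabilityMeasure P] (D : ℕ → Ω → ℝ) (hDm : ∀ k, Measurable (D k))
    {B : ℝ} (hB : 0 < B) (hDb : ∀ k ω, |D k ω| ≤ B) (n : ℕ)
    (horth : ∀ k < n, ∀ l : ℝ, ∫ ω, Real.exp (l * ∑ j ∈ Finset.range k, D j ω) * D k ω ∂P = 0) (l : ℝ) :
    ∫ ω, Real.exp (l * ∑ j ∈ Finset.range n, D j ω) ∂P ≤ Real.exp (n * (l ^ 2 * B ^ 2 / 2)) := by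
  induction n with
  | zero => simp
  | succ n ih =>
    have ih' := ih fun k hk => horth k (Nat.lt_succ_of_lt hk)
    -- the weight `Z = e^(λ S_n)`: non-negative, bounded, measurable, orthogonal to `D_n`
    set Z : Ω → ℝ := fun ω => Real.exp (l * ∑ j ∈ Finset.range n, D j ω) with hZ
    have hSm : Measurable fun ω => ∑ j ∈ Finset.range n, D j ω := Finset.measurable_sum _ fun j _ => hDm j
    have hZm : Measurable Z := (hSm.const_mul l).exp
    have hSb : ∀ ω, |∑ j ∈ Finset.range n, D j ω| ≤ n * B := fun ω =>
      (Finset.abs_sum_le_sum_abs _ _).trans (by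
        calc ∑ j ∈ Finset.range n, |D j ω| ≤ ∑ _j ∈ Finset.range n, B := Finset.sum_le_sum fun j _ => hDb j ω
          _ = n * B := by rw [Finset.sum_const, Finset.card_range, nsmul_eq_mul])
    have hZb : ∀ ω, Z ω ≤ Real.exp (|l| * (n * B)) := fun ω => by
      simp only [hZ, Real.exp_le_exp]
      calc l * ∑ j ∈ Finset.range n, D j ω ≤ |l * ∑ j ∈ Finset.range n, D j ω| := le_abs_self _
        _ = |l| * |∑ j ∈ Finset.range n, D j ω| := abs_mul _ _
        _ ≤ |l| * (n * B) := mul_le_mul_of_nonneg_left (hSb ω) (abs_nonneg l)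
    have step := integral_mul_exp_mul_le_of_orthogonal hZm (hDm n) (fun ω => (Real.exp_pos _).le) hZb hB (hDb n)
      (horth n (Nat.lt_succ_self n) l) l
    have heq : ∀ ω, Real.exp (l * ∑ j ∈ Finset.range (n + 1), D j ω) = Z ω * Real.exp (l * D n ω) := fun ω => by
      rw [Finset.sum_range_succ, mul_add, Real.exp_add]
    rw [integral_congr_ae (ae_of_all _ heq)]
    calc ∫ ω, Z ω * Real.exp (l * D n ω) ∂P ≤ Real.exp (l ^ 2 * B ^ 2 / 2) * ∫ ω, Z ω ∂P := step
      _ ≤ Real.exp (l ^ 2 * B ^ 2 / 2) * Real.exp (n * (l ^ 2 * B ^ 2 / 2)) :=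
          mul_le_mul_of_nonneg_left ih' (Real.exp_pos _).le
      _ = Real.exp (↑(n + 1) * (l ^ 2 * B ^ 2 / 2)) := by
          rw [← Real.exp_add]
          push_cast
          ring_nf

/-- ★★ **Sums of orthogonal bounded increments are sub-Gaussian** with parameter `n·B²` (Mathlib's `HasSubgaussianMGF`). [folklore] -/
theorem hasSubgaussianMGF_sum_of_orthogonal [IsProbabilityMeasure P] (D : ℕ → Ω → ℝ) (hDm : ∀ k, Measurable (D k))
    {B : ℝ} (hB : 0 < B) (hDb : ∀ k ω, |D k ω| ≤ B) (n : ℕ)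
    (horth : ∀ k < n, ∀ l : ℝ, ∫ ω, Real.exp (l * ∑ j ∈ Finset.range k, D j ω) * D k ω ∂P = 0) :
    HasSubgaussianMGF (fun ω => ∑ j ∈ Finset.range n, D j ω) ⟨n * B ^ 2, by positivity⟩ P where
  integrable_exp_mul t := by
    have hSm : Measurable fun ω => ∑ j ∈ Finset.range n, D j ω := Finset.measurable_sum _ fun j _ => hDm j
    have hSb : ∀ ω, |∑ j ∈ Finset.range n, D j ω| ≤ n * B := fun ω =>
      (Finset.abs_sum_le_sum_abs _ _).trans (by
        calc ∑ j ∈ Finset.range n, |D j ω| ≤ ∑ _j ∈ Finset.range n, B := Finset.sum_le_sum fun j _ => hDb j ω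
          _ = n * B := by rw [Finset.sum_const, Finset.card_range, nsmul_eq_mul])
    refine (integrable_const (Real.exp (|t| * (n * B)))).mono' (hSm.const_mul t).exp.aestronglyMeasurable
      (Eventually.of_forall fun ω => ?_)
    rw [Real.norm_eq_abs, abs_of_pos (Real.exp_pos _), Real.exp_le_exp]
    calc t * ∑ j ∈ Finset.range n, D j ω ≤ |t * ∑ j ∈ Finset.range n, D j ω| := le_abs_self _
      _ = |t| * |∑ j ∈ Finset.range n, D j ω| := abs_mul _ _
      _ ≤ |t| * (n * B) := mul_le_mul_of_nonneg_left (hSb ω) (abs_nonneg t)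
  mgf_le t := by
    have h := integral_exp_mul_sum_le_of_orthogonal D hDm hB hDb n horth t
    rw [mgf]
    calc ∫ ω, Real.exp (t * ∑ j ∈ Finset.range n, D j ω) ∂P ≤ Real.exp (n * (t ^ 2 * B ^ 2 / 2)) := h
      _ = Real.exp (((⟨n * B ^ 2, by positivity⟩ : ℝ≥0) : ℝ) * t ^ 2 / 2) := by
          rw [show ((⟨n * B ^ 2, by positivity⟩ : ℝ≥0) : ℝ) = n * B ^ 2 from rfl]
          ring_nf

/-- ★★ **Azuma–Hoeffding tail (one-sided)** for sums of orthogonal bounded increments: `P[S_n ≥ r] ≤ exp(−r²/(2nB²))` for `r ≥ 0`.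
[cite: GlynnOrmoneit2002, proof of Theorem 2] -/
theorem measureReal_sum_ge_le_of_orthogonal [IsProbabilityMeasure P] (D : ℕ → Ω → ℝ) (hDm : ∀ k, Measurable (D k))
    {B : ℝ} (hB : 0 < B) (hDb : ∀ k ω, |D k ω| ≤ B) (n : ℕ)
    (horth : ∀ k < n, ∀ l : ℝ, ∫ ω, Real.exp (l * ∑ j ∈ Finset.range k, D j ω) * D k ω ∂P = 0)
    {r : ℝ} (hr : 0 ≤ r) :
    P.real {ω | r ≤ ∑ j ∈ Finset.range n, D j ω} ≤ Real.exp (-r ^ 2 / (2 * (n * B ^ 2))) := by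
  have h := (hasSubgaussianMGF_sum_of_orthogonal D hDm hB hDb n horth).measure_ge_le hr
  exact h

/-- ★★ **Azuma–Hoeffding tail (two-sided)** for sums of orthogonal bounded increments: `P[|S_n| ≥ r] ≤ 2·exp(−r²/(2nB²))` for `r ≥ 0`.
[cite: GlynnOrmoneit2002, proof of Theorem 2] -/
theorem measureReal_abs_sum_ge_le_of_orthogonal [IsProbabilityMeasure P] (D : ℕ → Ω → ℝ) (hDm : ∀ k, Measurable (D k))
    {B : ℝ} (hB : 0 < B) (hDb : ∀ k ω, |D k ω| ≤ B) (n : ℕ)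
    (horth : ∀ k < n, ∀ l : ℝ, ∫ ω, Real.exp (l * ∑ j ∈ Finset.range k, D j ω) * D k ω ∂P = 0)
    {r : ℝ} (hr : 0 ≤ r) :
    P.real {ω | r ≤ |∑ j ∈ Finset.range n, D j ω|} ≤ 2 * Real.exp (-r ^ 2 / (2 * (n * B ^ 2))) := by
  have h₁ := measureReal_sum_ge_le_of_orthogonal D hDm hB hDb n horth hr
  -- the reflected increments `−D_k` satisfy the same hypotheses
  have hDm' : ∀ k, Measurable fun ω => -D k ω := fun k => (hDm k).neg
  have hDb' : ∀ k ω, |(-D k ω)| ≤ B := fun k ω => by rw [abs_neg]; exact hDb k ω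
  have horth' : ∀ k < n, ∀ l : ℝ, ∫ ω, Real.exp (l * ∑ j ∈ Finset.range k, -D j ω) * -D k ω ∂P = 0 := by
    intro k hk l
    have h := horth k hk (-l)
    have heq : ∀ ω, Real.exp (l * ∑ j ∈ Finset.range k, -D j ω) * -D k ω =
        -(Real.exp (-l * ∑ j ∈ Finset.range k, D j ω) * D k ω) := fun ω => by
      rw [Finset.sum_neg_distrib]
      ring_nf
    rw [integral_congr_ae (ae_of_all _ heq), integral_neg, h, neg_zero]
  have h₂ := measureReal_sum_ge_le_of_orthogonal (fun k ω => -D k ω) hDm' hB hDb' n horth' hr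
  have hsub : {ω | r ≤ |∑ j ∈ Finset.range n, D j ω|} ⊆
      {ω | r ≤ ∑ j ∈ Finset.range n, D j ω} ∪ {ω | r ≤ ∑ j ∈ Finset.range n, -D j ω} := by
    intro ω hω
    simp only [Set.mem_setOf_eq, Set.mem_union] at hω ⊢
    rw [Finset.sum_neg_distrib]
    rcases le_total 0 (∑ j ∈ Finset.range n, D j ω) with h0 | h0
    · left; rwa [abs_of_nonneg h0] at hω
    · right; rwa [abs_of_nonpos h0] at hω
  calc P.real {ω | r ≤ |∑ j ∈ Finset.range n, D j ω|}
      ≤ P.real ({ω | r ≤ ∑ j ∈ Finset.range n, D j ω} ∪ {ω | r ≤ ∑ j ∈ Finset.range n, -D j ω}) :=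
        measureReal_mono hsub
    _ ≤ P.real {ω | r ≤ ∑ j ∈ Finset.range n, D j ω} + P.real {ω | r ≤ ∑ j ∈ Finset.range n, -D j ω} :=
        measureReal_union_le _ _
    _ ≤ Real.exp (-r ^ 2 / (2 * (n * B ^ 2))) + Real.exp (-r ^ 2 / (2 * (n * B ^ 2))) := add_le_add h₁ h₂
    _ = 2 * Real.exp (-r ^ 2 / (2 * (n * B ^ 2))) := by ring

end Summit.QuantumFields.YangMills.Theorems.ColdStartUniversality

end
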